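import Summits.AtomisticToContinuum.Crystallization.Theses.PhononSlackCertificates

/-!
# Sketch — crux-ideate stmt-AtomisticToContinuum-13956 (`CoerciveTwoShellGap`), ideator 1, round 1

First lemmas of the two idea cards (statements must elaborate; proofs are not required at this
stage; the slice lemma of card A and the summation lemma of card B are proved below, no `sorry`).
-/

noncomputable section

namespace Summit.AtomisticToContinuum.Crystallization.Cruxes.CoerciveTwoShellGap.IdeatorOne

open scoped BigOperators Classical
open Literature.MathematicalPhysics.StatisticalMechanics Literature.Geometry.DiscreteGeometry
open Summit.AtomisticToContinuum.Crystallization.Theses.PhononSlackCertificates (CoerciveTwoShellGap)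

/-- Euclidean `3`-space. -/
local notation "E3" => EuclideanSpace ℝ (Fin 3)

/-- `e* = ⨅_Q e(Q)`, the periodic ground-state energy per particle of Lennard-Jones in `ℝ³`. -/
def ePer : ℝ := ⨅ Q : PeriodicConfiguration 3, Q.energyPerParticle lennardJones

/-! Site energies: the tree's `siteEnergy V x i = Σ_{k ≠ i} V(|x_i − x_k|)` (no factor ½;
`two_mul_interactionEnergy : 2·𝓔 = Σ_i siteEnergy`, `LennardJonesClusters.lean`). -/

/-! ## Card A — `capped-quadratic-misfit` -/

/-- FLOORED, CAPPED SQUARED TWO-SHELL MISFIT of particle `i` (floor `θₗ`, cap `θ₀`): the supremum of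
`ε² − θₗ²` over the tolerances `ε ∈ (θₗ, θ₀]` at which `i` is `ε`-BAD (two-shell predicate, window
`[47/50, 1]`), and `0` if `i` is good at every such tolerance.  By `IsTwoShellGood.mono` the bad
tolerances form an initial segment, so this is `(min(θ_i, θ₀)² − θₗ²)₊` for the bottleneck misfit
`θ_i` — a continuous order parameter, zero on every `θₗ`-good particle (in particular on the relaxed,
non-ideal-`c/a` hcp minimiser once `θₗ ≈ 1/50 ≫ 1e-3`: WITHOUT the floor the inequality below would be
refuted by the minimiser itself, the reason the crux is not quantified over `ε → 0`), whose
`1/20`-superlevel set is exactly the crux's bad set. -/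
def misfitSq (θₗ θ₀ : ℝ) {N : ℕ} (x : Fin N → E3) (i : Fin N) : ℝ :=
  sSup ({0} ∪ {t : ℝ | ∃ ε : ℝ, θₗ < ε ∧ ε ≤ θ₀ ∧ t = ε ^ 2 - θₗ ^ 2 ∧
    ¬ IsTwoShellGood ε (47 / 50) 1 x i})

/-- **C⁺ of card A (threshold-free, Łojasiewicz-type coercivity).**  For every separation `δ`
there is `c > 0` with `𝓔(x) ≥ N·e* + c·Σ_i (min(θ_i, θ₀)² − θₗ²)₊` for every `δ`-separated `x`. -/
def QuadraticMisfitCoercivity (θₗ θ₀ : ℝ) : Prop :=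
  ∀ δ : ℝ, 0 < δ → ∃ c : ℝ, 0 < c ∧ ∀ (N : ℕ) (x : Fin N → E3),
    (∀ i j : Fin N, i ≠ j → δ ≤ dist (x i) (x j)) →
      (N : ℝ) * ePer + c * ∑ i : Fin N, misfitSq θₗ θ₀ x i ≤ interactionEnergy lennardJones x

theorem misfitSq_bddAbove {θₗ : ℝ} (hℓ : 0 ≤ θₗ) (θ₀ : ℝ) {N : ℕ} (x : Fin N → E3) (i : Fin N) :
    BddAbove ({0} ∪ {t : ℝ | ∃ ε : ℝ, θₗ < ε ∧ ε ≤ θ₀ ∧ t = ε ^ 2 - θₗ ^ 2 ∧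
      ¬ IsTwoShellGood ε (47 / 50) 1 x i}) := by
  refine ⟨max 0 (θ₀ ^ 2), ?_⟩
  rintro t ht
  rcases ht with ht | ⟨ε, hε0, hεθ, rfl, -⟩
  · rw [Set.mem_singleton_iff] at ht
    rw [ht]
    exact le_max_left _ _
  · have h1 : ε ^ 2 ≤ θ₀ ^ 2 := pow_le_pow_left₀ (hℓ.trans hε0.le) hεθ 2
    have h2 : 0 ≤ θₗ ^ 2 := sq_nonneg θₗ
    exact le_trans (by linarith) (le_max_right _ _)

/-- The floored capped squared misfit is non-negative. -/
theorem misfitSq_nonneg {θₗ : ℝ} (hℓ : 0 ≤ θₗ) (θ₀ : ℝ) {N : ℕ} (x : Fin N → E3) (i : Fin N) :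
    0 ≤ misfitSq θₗ θ₀ x i :=
  le_csSup (misfitSq_bddAbove hℓ θ₀ x i) (Set.mem_union_left _ (Set.mem_singleton 0))

/-- A particle that is `ε`-bad for some `θₗ < ε ≤ θ₀` has floored capped squared misfit `≥ ε² − θₗ²`. -/
theorem sq_sub_sq_le_misfitSq {θₗ θ₀ ε : ℝ} (hℓ : 0 ≤ θₗ) {N : ℕ} {x : Fin N → E3} {i : Fin N}
    (hε0 : θₗ < ε) (hεθ : ε ≤ θ₀) (hbad : ¬ IsTwoShellGood ε (47 / 50) 1 x i) :
    ε ^ 2 - θₗ ^ 2 ≤ misfitSq θₗ θ₀ x i :=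
  le_csSup (misfitSq_bddAbove hℓ θ₀ x i) (Set.mem_union_right _ ⟨ε, hε0, hεθ, rfl, hbad⟩)

/-- **First lemma of card A (the slice).**  Any floor `0 ≤ θₗ < 1/20` and cap `θ₀ ≥ 1/20` give the
crux with `g = c·((1/20)² − θₗ²)` (e.g. `θₗ = 1/50`: `g = 21c/10000`): the floored misfit is
`≥ (1/20)² − θₗ²` at every `1/20`-bad particle and `≥ 0` everywhere. -/
theorem coerciveTwoShellGap_of_quadraticMisfitCoercivity {θₗ θ₀ : ℝ} (hℓ : 0 ≤ θₗ)
    (hℓ' : θₗ < 1 / 20) (hθ : 1 / 20 ≤ θ₀) :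
    QuadraticMisfitCoercivity θₗ θ₀ → CoerciveTwoShellGap := by
  intro h δ hδ
  obtain ⟨c, hc, hcx⟩ := h δ hδ
  have hgap : 0 < (1 / 20 : ℝ) ^ 2 - θₗ ^ 2 := by
    have : θₗ ^ 2 < (1 / 20 : ℝ) ^ 2 := pow_lt_pow_left₀ hℓ' hℓ (by norm_num)
    linarith
  refine ⟨c * ((1 / 20 : ℝ) ^ 2 - θₗ ^ 2), mul_pos hc hgap, fun N x hx => ?_⟩
  have hE := hcx N x hx
  have hcard : (Nat.card {i : Fin N // ¬ IsTwoShellGood (1 / 20) (47 / 50) 1 x i} : ℝ)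
      = ∑ i : Fin N, (if ¬ IsTwoShellGood (1 / 20) (47 / 50) 1 x i then (1 : ℝ) else 0) := by
    rw [Nat.card_eq_fintype_card, Fintype.card_subtype, Finset.natCast_card_filter]
  have hsum : ((1 / 20 : ℝ) ^ 2 - θₗ ^ 2) * ∑ i : Fin N, (if ¬ IsTwoShellGood (1 / 20) (47 / 50) 1 x i
      then (1 : ℝ) else 0) ≤ ∑ i : Fin N, misfitSq θₗ θ₀ x i := by
    rw [Finset.mul_sum]
    refine Finset.sum_le_sum fun i _ => ?_
    split_ifs with hgood
    · rw [mul_zero]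
      exact misfitSq_nonneg hℓ θ₀ x i
    · rw [mul_one]
      exact sq_sub_sq_le_misfitSq hℓ hℓ' hθ hgood
  have hmain : (N : ℝ) * ePer + c * ((1 / 20 : ℝ) ^ 2 - θₗ ^ 2) *
      (Nat.card {i : Fin N // ¬ IsTwoShellGood (1 / 20) (47 / 50) 1 x i} : ℝ)
        ≤ interactionEnergy lennardJones x := by
    rw [hcard]
    have h2 := mul_le_mul_of_nonneg_left hsum hc.le
    have h3 : c * ((1 / 20 : ℝ) ^ 2 - θₗ ^ 2) * ∑ i : Fin N, (if ¬ IsTwoShellGood (1 / 20) (47 / 50) 1 x i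
        then (1 : ℝ) else 0) = c * (((1 / 20 : ℝ) ^ 2 - θₗ ^ 2) * ∑ i : Fin N,
          (if ¬ IsTwoShellGood (1 / 20) (47 / 50) 1 x i then (1 : ℝ) else 0)) := by ring
    rw [h3]
    linarith
  simpa only [ePer] using hmain

/-- **Torus form of C⁺** (the home of the line's proof; equivalent to the finite form by
periodisation with period `> diam + 3` and by blocks, as in `Cruxes/StarCoercivity/Disproof.lean`
§9/§12 for the one-shell predicate): every periodic configuration pays `c` times the mean floored
capped squared misfit of its motif, misfit read in the infinite point set `P.points`. -/
def TorusQuadraticMisfitCoercivity (θₗ θ₀ δ : ℝ) : Prop :=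
  ∃ c : ℝ, 0 < c ∧ ∀ P : PeriodicConfiguration 3,
    (∀ p ∈ P.points, ∀ q ∈ P.points, p ≠ q → δ ≤ dist p q) →
      ePer + c * (P.motif.card : ℝ)⁻¹ *
          ∑ y ∈ P.motif, sSup ({0} ∪ {t : ℝ | ∃ ε : ℝ, θₗ < ε ∧ ε ≤ θ₀ ∧ t = ε ^ 2 - θₗ ^ 2 ∧
            ¬ IsTwoShellGoodSet ε (47 / 50) 1 P.points y})
        ≤ P.energyPerParticle lennardJones

/-! ## Card B — `gauged-star-inequality` -/

/-- A LOCAL TRANSFER RULE of radius `R` and size `B`: to every finite configuration it assigns an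
antisymmetric matrix `τ x i j` (energy moved from the ledger of `j` to the ledger of `i`), zero
beyond distance `R`, bounded by `B`, and LOCAL: `τ x i j` only depends on the configuration inside
the `2R`-balls about `x i` and `x j`. -/
structure TransferRule (R B : ℝ) where
  /-- the transfer -/
  τ : {N : ℕ} → (Fin N → E3) → Fin N → Fin N → ℝ
  antisymm : ∀ {N : ℕ} (x : Fin N → E3) (i j : Fin N), τ x j i = -τ x i j
  bounded : ∀ {N : ℕ} (x : Fin N → E3) (i j : Fin N), |τ x i j| ≤ B
  finiteRange : ∀ {N : ℕ} (x : Fin N → E3) (i j : Fin N), R < dist (x i) (x j) → τ x i j = 0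
  isLocal : ∀ {N : ℕ} (x y : Fin N → E3) (i j : Fin N),
    (∀ k : Fin N, (dist (x k) (x i) ≤ 2 * R ∨ dist (x k) (x j) ≤ 2 * R ∨
        dist (y k) (y i) ≤ 2 * R ∨ dist (y k) (y j) ≤ 2 * R) → y k = x k) →
      τ y i j = τ x i j

/-- The `R`-truncated site energy `Σ_{k ≠ i, |x_i − x_k| ≤ R} V(|x_i − x_k|)` (the part a local rule can see). -/
def truncSiteEnergy (R : ℝ) {N : ℕ} (x : Fin N → E3) (i : Fin N) : ℝ :=
  ∑ k ∈ (Finset.univ.erase i).filter (fun k => dist (x i) (x k) ≤ R), lennardJones (dist (x i) (x k))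

/-- The tail of the site energy beyond `R`. -/
def tailSiteEnergy (R : ℝ) {N : ℕ} (x : Fin N → E3) (i : Fin N) : ℝ :=
  ∑ k ∈ (Finset.univ.erase i).filter (fun k => ¬ dist (x i) (x k) ≤ R), lennardJones (dist (x i) (x k))

/-- `siteEnergy = truncSiteEnergy R + tailSiteEnergy R`. -/
theorem siteEnergy_eq_trunc_add_tail (R : ℝ) {N : ℕ} (x : Fin N → E3) (i : Fin N) :
    siteEnergy lennardJones x i = truncSiteEnergy R x i + tailSiteEnergy R x i := by
  unfold siteEnergy truncSiteEnergy tailSiteEnergy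
  rw [Finset.sum_filter_add_sum_filter_not]

/-- **C⁺ of card B (one pointwise star inequality everywhere + one global tail inequality).**  For
every separation `δ` there are `g > 0`, a radius `R`, a bound `B`, ONE local transfer rule `T` and a
sitewise REFERENCE VALUE `eref` (in the line: the `R`-truncated Barlow energy per particle at the
particle's fitted scale `a_i` — never `e*` itself, which no finite-range rule can meet exactly
because of the tail tension) such that (a) POINTWISE at every particle of every `δ`-separated
configuration, half the `R`-truncated site energy plus the transfers is at least `eref`, plus `g`
if the particle is `1/20`-bad; (b) GLOBALLY the references plus half the tails dominate `N·e*`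
(the sitewise TailCharge: `e_R(a) + e_tail(a) ≥ e*` for every scale by `ciInf_le`, and density
fluctuations only raise the tail, `⟨ρ, Kρ⟩ ≤ ⟨ρ, ρ⟩`).  The line's full (a) adds `+ κ·misfitSq` at
good particles. -/
def PointwiseStarInequality : Prop :=
  ∀ δ : ℝ, 0 < δ → ∃ g : ℝ, 0 < g ∧ ∃ R B : ℝ, ∃ T : TransferRule R B,
    ∃ eref : (N : ℕ) → (Fin N → E3) → Fin N → ℝ,
      (∀ (N : ℕ) (x : Fin N → E3), (∀ i j : Fin N, i ≠ j → δ ≤ dist (x i) (x j)) →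
        ∀ i : Fin N, eref N x i + (if IsTwoShellGood (1 / 20) (47 / 50) 1 x i then 0 else g)
          ≤ (1 / 2) * truncSiteEnergy R x i + ∑ j : Fin N, T.τ x i j) ∧
      (∀ (N : ℕ) (x : Fin N → E3), (∀ i j : Fin N, i ≠ j → δ ≤ dist (x i) (x j)) →
        (N : ℝ) * ePer ≤ ∑ i : Fin N, (eref N x i + (1 / 2) * tailSiteEnergy R x i))

/-- **First lemma of card B (summation).**  Antisymmetry kills `Σ_i Σ_j τ`, `Σ_i (trunc + tail)/2 =
𝓔(x)`, and (b) trades the references and tails for `N e*`: (a) ∧ (b) sum to the crux with the same `g`. -/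
theorem coerciveTwoShellGap_of_pointwiseStarInequality :
    PointwiseStarInequality → CoerciveTwoShellGap := by
  intro h δ hδ
  obtain ⟨g, hg, R, B, T, eref, hpt, htail⟩ := h δ hδ
  refine ⟨g, hg, fun N x hx => ?_⟩
  have hp := hpt N x hx
  have ht := htail N x hx
  -- the transfers cancel
  have hτ : ∑ i : Fin N, ∑ j : Fin N, T.τ x i j = 0 := by
    have h1 : ∑ i : Fin N, ∑ j : Fin N, T.τ x i j = ∑ i : Fin N, ∑ j : Fin N, T.τ x j i :=
      Finset.sum_comm
    have h2 : ∑ i : Fin N, ∑ j : Fin N, T.τ x j i = -∑ i : Fin N, ∑ j : Fin N, T.τ x i j := by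
      rw [← Finset.sum_neg_distrib]
      refine Finset.sum_congr rfl fun i _ => ?_
      rw [← Finset.sum_neg_distrib]
      exact Finset.sum_congr rfl fun j _ => T.antisymm x i j
    linarith
  -- the truncated and tail site energies sum to the energy
  have hsite : ∑ i : Fin N, ((1 / 2 : ℝ) * truncSiteEnergy R x i + ∑ j : Fin N, T.τ x i j)
      + ∑ i : Fin N, (1 / 2 : ℝ) * tailSiteEnergy R x i = interactionEnergy lennardJones x := by
    rw [Finset.sum_add_distrib, hτ, add_zero, ← Finset.sum_add_distrib]
    have : ∀ i : Fin N, (1 / 2 : ℝ) * truncSiteEnergy R x i + 1 / 2 * tailSiteEnergy R x i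
        = (1 / 2 : ℝ) * siteEnergy lennardJones x i := fun i => by
      rw [siteEnergy_eq_trunc_add_tail R x i]; ring
    rw [Finset.sum_congr rfl fun i _ => this i, ← Finset.mul_sum, ← two_mul_interactionEnergy]
    ring
  -- the charges sum to `Σ eref + g #bad`
  have hcard : (Nat.card {i : Fin N // ¬ IsTwoShellGood (1 / 20) (47 / 50) 1 x i} : ℝ)
      = ∑ i : Fin N, (if ¬ IsTwoShellGood (1 / 20) (47 / 50) 1 x i then (1 : ℝ) else 0) := by
    rw [Nat.card_eq_fintype_card, Fintype.card_subtype, Finset.natCast_card_filter]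
  have hlhs : ∑ i : Fin N, (eref N x i + (if IsTwoShellGood (1 / 20) (47 / 50) 1 x i then 0 else g))
      = ∑ i : Fin N, eref N x i + g *
        (Nat.card {i : Fin N // ¬ IsTwoShellGood (1 / 20) (47 / 50) 1 x i} : ℝ) := by
    rw [hcard, Finset.sum_add_distrib, Finset.mul_sum]
    congr 1
    refine Finset.sum_congr rfl fun i _ => ?_
    split_ifs <;> simp
  have hsum : ∑ i : Fin N, (eref N x i + (if IsTwoShellGood (1 / 20) (47 / 50) 1 x i then 0 else g))
      ≤ ∑ i : Fin N, ((1 / 2 : ℝ) * truncSiteEnergy R x i + ∑ j : Fin N, T.τ x i j) :=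
    Finset.sum_le_sum fun i _ => hp i
  rw [hlhs] at hsum
  have ht' : (N : ℝ) * ePer ≤ ∑ i : Fin N, eref N x i + ∑ i : Fin N, (1 / 2 : ℝ) * tailSiteEnergy R x i := by
    simpa [Finset.sum_add_distrib] using ht
  have : (N : ℝ) * ePer + g * (Nat.card {i : Fin N // ¬ IsTwoShellGood (1 / 20) (47 / 50) 1 x i} : ℝ)
      ≤ interactionEnergy lennardJones x := by
    rw [← hsite]; linarith
  simpa only [ePer] using this

end Summit.AtomisticToContinuum.Crystallization.Cruxes.CoerciveTwoShellGap.IdeatorOne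

end
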